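import Literature.NumberTheory.ModularForms.EisensteinLatticeCosetRational
import HarnessLib

/-!
# The Galois action on the `q_N`-expansion of `G_k^a`: `σ(c_k G_k^{(a₀,a₁)}) = c_k G_k^{(a₀, d a₁)}`
# for `σ(ζ_N) = ζ_N^d`

Topic `Literature/NumberTheory/ModularForms`; namespace `Literature.NumberTheory.ModularForms`.
Sequel of `EisensteinLatticeCosetRational`.  THEOREMS ONLY (no definition, no named fact).

For a ring endomorphism `σ` of `ℂ` with `σ(e^{2πi/N}) = e^{2πi d/N}` (`d ∈ ℤ`), applying `σ` to the
normalised Fourier coefficients `c_k bₙ(G_k^a)` (`c_k = (k-1)! N^k/(-2πi)^k`, Diamond–Shurman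
Thm. 4.2.3) of the Eisenstein series `G_k^a` over the class `a = (a₀, a₁) ∈ (ℤ/Nℤ)²` gives the
coefficients of `G_k^{a'}`, `a' = (a₀, d a₁) = a · diag(1, d)`:

* `map_latticeEisensteinWeight` — `σ(w_a(c, m)) = w_{a'}(c, m)` (the weights are
  `[c ≡ a₀] ζ_N^{ã₁ m} + (-1)^k [c ≡ -a₀] ζ_N^{-ã₁ m}`);
* `map_latticeEisensteinNorm_mul_cosetZeta` — the constant term, through its Bernoulli–Hurwitz
  form `cosetZeta_eq_sum_bernoulliFun`;
* `map_latticeEisensteinNorm_mul_coeff`, **`map_latticeEisensteinNorm_mul_qExpansion_coeff`** —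
  `σ(c_k · coeff n (qExpansion N G_k^a)) = c_k · coeff n (qExpansion N G_k^{a·diag(1,d)})`.

This is the action of `(1 0; 0 d) ∈ GL₂(ℤ/Nℤ)` on the Eisenstein part of the modular function
field of level `N` (Shimura 1971, §6.1–6.2, the action of `GL₂(ℤ/Nℤ)` on `𝔉_N` through
`ι(1,d) ↦ σ_d`; Diamond–Shurman §7.7), the input of the Galois-action half of the `q`-expansion
principle at all cusps (`GammaTranslatesGalois*`).

## References

* [DiamondShurman2005] F. Diamond, J. Shurman, *A First Course in Modular Forms*, GTM 228
  (2005), §4.2 Thm. 4.2.3, §7.7.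
* [ShimuraIATAF1971] G. Shimura, *Introduction to the arithmetic theory of automorphic
  functions*, Princeton (1971), §6.1–6.2 (Thm. 6.6 and the action of `GL₂(ℤ/Nℤ)` on `𝔉_N`).
-/

noncomputable section

namespace Literature.NumberTheory.ModularForms

open scoped MatrixGroups Real CongruenceSubgroup Matrix
open UpperHalfPlane hiding I
open EisensteinSeries Complex Filter Function PowerSeries

section Galois

variable {N : ℕ} [NeZero N] {k : ℕ} (σ : ℂ →+* ℂ) {d : ℤ}

omit [NeZero N] in
/-- `σ(e^{2πi m/N}) = e^{2πi d m/N}` when `σ(e^{2πi/N}) = e^{2πi d/N}`. [folklore] -/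
private theorem map_cexp_natMul_div (hσ : σ (cexp (2 * π * Complex.I / N)) = cexp (2 * π * Complex.I * d / N))
    (m : ℕ) : σ (cexp (2 * π * Complex.I * m / N)) = cexp (2 * π * Complex.I * (d * m) / N) := by
  rw [show (2 * π * Complex.I * m / N : ℂ) = (m : ℂ) * (2 * π * Complex.I / N) by ring,
    Complex.exp_nat_mul, map_pow, hσ, ← Complex.exp_nat_mul]
  congr 1
  ring

omit [NeZero N] in
/-- `σ(e^{-2πi m/N}) = e^{-2πi d m/N}` when `σ(e^{2πi/N}) = e^{2πi d/N}`. [folklore] -/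
private theorem map_cexp_neg_natMul_div (hσ : σ (cexp (2 * π * Complex.I / N)) = cexp (2 * π * Complex.I * d / N))
    (m : ℕ) : σ (cexp (-(2 * π * Complex.I * m / N))) = cexp (-(2 * π * Complex.I * (d * m) / N)) := by
  rw [Complex.exp_neg, map_inv₀, map_cexp_natMul_div σ hσ, Complex.exp_neg]

/-- `e^{2πi · r̃ · m/N}` only depends on `r mod N`: for the representative `((d a)~)` of `d · a` one
has `e^{2πi (d a)~ m /N} = e^{2πi d ã m/N}`. [folklore] -/
private theorem cexp_val_intCast_mul (a : ZMod N) (m : ℤ) :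
    cexp (2 * π * Complex.I * ((((d : ZMod N) * a).val : ℂ) * m) / N) =
      cexp (2 * π * Complex.I * (d * (a.val : ℂ) * m) / N) := by
  -- `((d a)~ : ℤ) ≡ d · ã (mod N)`
  have hcong : (((((d : ZMod N) * a).val : ℕ) : ℤ) : ZMod N) = ((d * (a.val : ℤ) : ℤ) : ZMod N) := by
    push_cast
    rw [ZMod.natCast_zmod_val, ZMod.natCast_zmod_val]
  rw [ZMod.intCast_eq_intCast_iff] at hcong
  obtain ⟨q, hq⟩ := Int.modEq_iff_dvd.mp hcong.symm
  have hN : (N : ℂ) ≠ 0 := by exact_mod_cast NeZero.ne N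
  have hval : ((((d : ZMod N) * a).val : ℕ) : ℂ) = (d : ℂ) * (a.val : ℂ) + (N : ℂ) * q := by
    have := congrArg (fun z : ℤ ↦ (z : ℂ)) hq
    push_cast at this
    linear_combination this
  rw [hval, show (2 * π * Complex.I * (((d : ℂ) * (a.val : ℂ) + (N : ℂ) * q) * m) / N : ℂ) =
      2 * π * Complex.I * (d * (a.val : ℂ) * m) / N + ((q * m : ℤ) : ℂ) * (2 * π * Complex.I) by
        push_cast; field_simp; try ring]
  simp only [Complex.exp_add, Complex.exp_int_mul_two_pi_mul_I, mul_one]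

/-- **`σ` on the weights**: `σ(w_{(a₀,a₁)}(c, m)) = w_{(a₀, d a₁)}(c, m)` for `σ(ζ_N) = ζ_N^d`.
[cite: DiamondShurman2005, Thm. 4.2.3] -/
theorem map_latticeEisensteinWeight (hσ : σ (cexp (2 * π * Complex.I / N)) = cexp (2 * π * Complex.I * d / N))
    (a : Fin 2 → ZMod N) (c m : ℕ) :
    σ (latticeEisensteinWeight N k a c m) = latticeEisensteinWeight N k ![a 0, (d : ZMod N) * a 1] c m := by
  unfold latticeEisensteinWeight
  simp only [Matrix.cons_val_zero, Matrix.cons_val_one, map_add, map_mul,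
    map_pow, map_neg, map_one]
  congr 1
  · split_ifs
    · have h1 := map_cexp_natMul_div σ hσ ((a 1).val * m)
      push_cast at h1
      rw [h1]
      have h2 := cexp_val_intCast_mul (d := d) (a 1) (m : ℤ)
      push_cast at h2
      rw [h2]
      congr 1; ring
    · exact map_zero σ
  · congr 1
    split_ifs
    · have h1 := map_cexp_neg_natMul_div σ hσ ((a 1).val * m)
      push_cast at h1
      rw [h1]
      have h2 := cexp_val_intCast_mul (d := d) (a 1) (m : ℤ)
      push_cast at h2
      rw [Complex.exp_neg, Complex.exp_neg, h2]
      congr 2; ring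
    · exact map_zero σ

/-- **`σ` on the constant term**: `σ(c_k Z_k(a₁)) = c_k Z_k(d a₁)` (`k ≥ 2`), through the
Bernoulli–Hurwitz form `c_k Z_k(a₁) = (-1)^{k+1}(N^{k-1}/k) ∑_x ζ_N^{-x̃ ã₁} B_k(x̃/N)`.
[cite: DiamondShurman2005, Thm. 4.2.3 and §4.7] -/
theorem map_latticeEisensteinNorm_mul_cosetZeta
    (hσ : σ (cexp (2 * π * Complex.I / N)) = cexp (2 * π * Complex.I * d / N)) (hk : 2 ≤ k) (a₁ : ZMod N) :
    σ (latticeEisensteinNorm N k * cosetZeta N k a₁) =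
      latticeEisensteinNorm N k * cosetZeta N k ((d : ZMod N) * a₁) := by
  -- `c_k Z_k(b) = r · ∑_x ζ^{-x̃ b̃} B_k(x̃/N)` with a rational `r`
  have key : ∀ b : ZMod N, latticeEisensteinNorm N k * cosetZeta N k b =
      (((-1) ^ (k + 1) * (N : ℚ) ^ (k - 1) / k : ℚ) : ℂ) *
        ∑ x : ZMod N, cexp (-(2 * π * Complex.I * (x.val * b.val) / N)) *
          (bernoulliFun k ((x.val : ℝ) / N) : ℂ) := by
    intro b
    rw [cosetZeta_eq_sum_bernoulliFun N k hk, ← mul_assoc, latticeEisensteinNorm_mul_bernoulliConst N k (by omega)]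
  rw [key, key, map_mul, map_ratCast, map_sum]
  congr 1
  refine Finset.sum_congr rfl fun x _ ↦ ?_
  have hB : (bernoulliFun k ((x.val : ℝ) / N) : ℂ) =
      (((Polynomial.bernoulli k).eval ((x.val : ℚ) / N) : ℚ) : ℂ) := by
    have h1 : ((x.val : ℝ) / N) = algebraMap ℚ ℝ ((x.val : ℚ) / N) := by
      rw [eq_ratCast]; push_cast; rfl
    rw [bernoulliFun, Polynomial.eval_map, h1, Polynomial.eval₂_at_apply, eq_ratCast,
      Complex.ofReal_ratCast]
  rw [map_mul, hB, map_ratCast]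
  congr 1
  have h1 := map_cexp_neg_natMul_div σ hσ (x.val * a₁.val)
  push_cast at h1
  rw [h1]
  have h2 := cexp_val_intCast_mul (d := d) a₁ (x.val : ℤ)
  push_cast at h2
  rw [Complex.exp_neg, Complex.exp_neg]
  congr 1
  rw [show (2 * π * Complex.I * ((x.val : ℂ) * ((((d : ZMod N) * a₁).val : ℕ) : ℂ)) / N : ℂ) =
      2 * π * Complex.I * (((((d : ZMod N) * a₁).val : ℕ) : ℂ) * (x.val : ℂ)) / N by ring, h2]
  congr 1; ring

/-- **`σ` on all coefficients**: `σ(c_k bₙ(G_k^{(a₀,a₁)})) = c_k bₙ(G_k^{(a₀, d a₁)})` (`k ≥ 2`).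
[cite: DiamondShurman2005, Thm. 4.2.3] -/
theorem map_latticeEisensteinNorm_mul_coeff
    (hσ : σ (cexp (2 * π * Complex.I / N)) = cexp (2 * π * Complex.I * d / N)) (hk : 2 ≤ k)
    (a : Fin 2 → ZMod N) (n : ℕ) :
    σ (latticeEisensteinNorm N k * latticeEisensteinCoeff N k a n) =
      latticeEisensteinNorm N k * latticeEisensteinCoeff N k ![a 0, (d : ZMod N) * a 1] n := by
  unfold latticeEisensteinCoeff
  simp only [Matrix.cons_val_zero, Matrix.cons_val_one]
  split_ifs with hn ha
  · exact map_latticeEisensteinNorm_mul_cosetZeta σ hσ hk (a 1)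
  · rw [mul_zero, map_zero]
  · have h1 : ∀ s : ℂ, latticeEisensteinNorm N k *
        (((N : ℂ) ^ k)⁻¹ * ((-2 * π * Complex.I) ^ k / (k - 1).factorial) * s) = s := fun s ↦ by
      rw [← mul_assoc, latticeEisensteinNorm_mul_const, one_mul]
    rw [h1, h1, map_sum]
    refine Finset.sum_congr rfl fun p _ ↦ ?_
    rw [map_mul, map_pow, map_natCast, map_latticeEisensteinWeight σ hσ]

/-- **The Galois action on the `q_N`-expansion of `G_k^a`** (`k ≥ 3`): for a ring endomorphism `σ`
of `ℂ` with `σ(e^{2πi/N}) = e^{2πi d/N}`,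
`σ(c_k · coeff n (qExpansion N G_k^{(a₀,a₁)})) = c_k · coeff n (qExpansion N G_k^{(a₀, d a₁)})`.
This is the action of `(1 0; 0 d) ∈ GL₂(ℤ/Nℤ)` on the Eisenstein series of level `Γ(N)`.
[cite: DiamondShurman2005, Thm. 4.2.3 and §7.7] [cite: ShimuraIATAF1971, §6.2] -/
theorem map_latticeEisensteinNorm_mul_qExpansion_coeff
    (hσ : σ (cexp (2 * π * Complex.I / N)) = cexp (2 * π * Complex.I * d / N)) (hk : 3 ≤ k)
    (a : Fin 2 → ZMod N) (n : ℕ) :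
    σ (latticeEisensteinNorm N k *
        (qExpansion (N : ℝ) (latticeEisensteinMF N (k := (k : ℤ)) (by exact_mod_cast hk) a)).coeff n) =
      latticeEisensteinNorm N k *
        (qExpansion (N : ℝ) (latticeEisensteinMF N (k := (k : ℤ)) (by exact_mod_cast hk)
          ![a 0, (d : ZMod N) * a 1])).coeff n := by
  rw [qExpansion_coeff_latticeEisensteinMF N k a hk n, qExpansion_coeff_latticeEisensteinMF N k _ hk n]
  exact map_latticeEisensteinNorm_mul_coeff σ hσ (by omega) a n

end Galois

end Literature.NumberTheory.ModularForms

end
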